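import Summits.CriticalPhenomena.PercolationContinuityZ3.Theorems.PercNearOneGluingNoHeavyLowerTailWorstPairExchangeIdentity
import Summits.CriticalPhenomena.PercolationContinuityZ3.Theorems.PercNearOneGluingNoHeavyLowerTailLonelyRelay
import HarnessLib

/-!
# `NoHeavyLowerTail` (stmt-CriticalPhenomena-4575) — HARMONIC EVENT GLUING: `X ≤ H_{|A|} · max_a P(a ↮ c)`

Support file (prover prim-gen-kcluster; `--supports stmt-CriticalPhenomena-4575`).  No definitions, no sorries.

For `μ = prodBernoulli w`, observer `o`, sink `c`, relay set `A` with `c ∉ A`, and `s ≥ max_{a∈A} μ(a ↮ c)`: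

  `μ({o ↮ c} ∩ ⋃_{a ∈ A} {o ↔ a}) ≤ H_{|A|} · s`,   `H_k = Σ_{j=1}^{k} 1/j`          (`eventGluing_harmonic`).

This is event gluing (Kozma–Nitzan's additive conjecture in event form) with a HARMONIC loss `H_k ≈ ln k + 0.58`,
versus the tree's `logGluing` (`16 (⌊log₂ k⌋ + 1)`); the crux is the removal of the logarithm.  Proof (new, elementary
given the tree): for every `x ∈ A` the exit event splits EXACTLY as `X(A) = X(A ∖ x) + μ(pocket = {x})`
(`exit_split_erase`); averaging over `x ∈ A` and bounding `Σ_x μ(pocket = {x}) ≤ s` by the LONELY RELAY LEMMA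
(`Theorems.lonelyRelay`, KN Lemma 2, applied to `A ∪ {c}`) gives the recursion `X_k ≤ X_{k−1} + s/k`.
-/

noncomputable section

namespace Summit.CriticalPhenomena.PercolationContinuityZ3.Theorems

open MeasureTheory Set Literature.Probability.LatticeModels Literature.Probability.Percolation
open scoped Classical BigOperators

namespace HarmonicGluing

variable {n : ℕ}

/-- Exact split of the exit event at a relay `x ∈ A`: `X(A) = X(A ∖ {x}) + μ(pocket x)`. [this file] -/
theorem exit_split_erase (w : Sym2 (Fin n) → unitInterval) (A : Finset (Fin n)) (o c x : Fin n) (hx : x ∈ A) :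
    (prodBernoulli w).real ((openConn o c : Set (BondConfig (Fin n)))ᶜ ∩ ⋃ y ∈ A, openConn o y) =
      (prodBernoulli w).real ((openConn o c : Set (BondConfig (Fin n)))ᶜ ∩ ⋃ y ∈ A.erase x, openConn o y) +
        (prodBernoulli w).real
          ((openConn o c : Set (BondConfig (Fin n)))ᶜ ∩ (openConn o x) ∩ ⋂ y ∈ A.erase x, (openConn o y)ᶜ) := by
  rw [← measureReal_union ?_ MeasurableSet.of_discrete]
  · congr 1
    ext ω
    simp only [mem_inter_iff, mem_compl_iff, mem_union, mem_iUnion, mem_iInter, exists_prop,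
      Finset.mem_erase]
    constructor
    · rintro ⟨hoc, y, hyA, hoy⟩
      by_cases h : ∃ z, (z ≠ x ∧ z ∈ A) ∧ ω ∈ (openConn o z : Set (BondConfig (Fin n)))
      · exact Or.inl ⟨hoc, h⟩
      · push Not at h
        have hyx : y = x := by
          by_contra hne
          exact h y ⟨hne, hyA⟩ hoy
        subst hyx
        exact Or.inr ⟨⟨hoc, hoy⟩, fun z hz => h z hz⟩
    · rintro (⟨hoc, y, ⟨_, hyA⟩, hoy⟩ | ⟨⟨hoc, hox⟩, _⟩)
      · exact ⟨hoc, y, hyA, hoy⟩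
      · exact ⟨hoc, x, hx, hox⟩
  · rw [Set.disjoint_left]
    rintro ω ⟨_, hU⟩ ⟨_, hI⟩
    simp only [mem_iUnion, exists_prop] at hU
    obtain ⟨y, hy, hoy⟩ := hU
    exact (mem_iInter₂.1 hI y hy) hoy

/-- The singleton pockets are pairwise disjoint. [this file] -/
theorem pocket_disjoint (A : Finset (Fin n)) (o c : Fin n) :
    (A : Set (Fin n)).PairwiseDisjoint (fun x =>
      ((openConn o c : Set (BondConfig (Fin n)))ᶜ ∩ (openConn o x) ∩ ⋂ y ∈ A.erase x, (openConn o y)ᶜ)) := by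
  intro x hx y hy hxy
  rw [Function.onFun, Set.disjoint_left]
  rintro ω ⟨⟨_, hox⟩, hIx⟩ ⟨⟨_, hoy⟩, _⟩
  have : ω ∈ (openConn o y : Set (BondConfig (Fin n)))ᶜ :=
    mem_iInter₂.1 hIx y (Finset.mem_erase.2 ⟨fun h => hxy h.symm, hy⟩)
  exact this hoy

/-- Each singleton pocket lies in the lonely-relay event of `A ∪ {c}`: exactly one of the vertices of
`insert c A` is joined to `o`. [this file] -/
theorem pocket_subset_lonely (A : Finset (Fin n)) (o c x : Fin n) (hx : x ∈ A) (hc : c ∉ A) :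
    ((openConn o c : Set (BondConfig (Fin n)))ᶜ ∩ (openConn o x) ∩ ⋂ y ∈ A.erase x, (openConn o y)ᶜ) ⊆
      {ω : BondConfig (Fin n) | ((insert c A).filter fun a => ω ∈ openConn o a).card = 1} := by
  rintro ω ⟨⟨hoc, hox⟩, hI⟩
  simp only [mem_setOf_eq]
  rw [Finset.card_eq_one]
  refine ⟨x, ?_⟩
  ext a
  simp only [Finset.mem_filter, Finset.mem_insert, Finset.mem_singleton]
  constructor
  · rintro ⟨ha | ha, hoa⟩
    · subst ha; exact absurd hoa hoc
    · by_contra hax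
      exact (mem_iInter₂.1 hI a (Finset.mem_erase.2 ⟨hax, ha⟩)) hoa
  · rintro rfl
    exact ⟨Or.inr hx, hox⟩

/-- **Sum of the singleton pockets** `≤ s` (lonely relay lemma on `A ∪ {c}`). [this file] -/
theorem sum_pocket_le (w : Sym2 (Fin n) → unitInterval) (A : Finset (Fin n)) (o c : Fin n) (s : ℝ)
    (hs : 0 ≤ s) (hc : c ∉ A) (hA : A.Nonempty)
    (hcut : ∀ a ∈ A, (prodBernoulli w).real (openConn a c : Set (BondConfig (Fin n)))ᶜ ≤ s) :
    ∑ x ∈ A, (prodBernoulli w).real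
        ((openConn o c : Set (BondConfig (Fin n)))ᶜ ∩ (openConn o x) ∩ ⋂ y ∈ A.erase x, (openConn o y)ᶜ) ≤ s := by
  set μ := prodBernoulli w with hμ
  rw [← measureReal_biUnion_finset (pocket_disjoint A o c) (fun _ _ => MeasurableSet.of_discrete)]
  have hsub : (⋃ x ∈ A, ((openConn o c : Set (BondConfig (Fin n)))ᶜ ∩ (openConn o x) ∩ ⋂ y ∈ A.erase x, (openConn o y)ᶜ)) ⊆
      {ω : BondConfig (Fin n) | ((insert c A).filter fun a => ω ∈ openConn o a).card = 1} := by
    intro ω hω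
    simp only [mem_iUnion, exists_prop] at hω
    obtain ⟨x, hx, hωx⟩ := hω
    exact pocket_subset_lonely A o c x hx hc hωx
  refine le_trans (measureReal_mono hsub) ?_
  refine lonelyRelay n w (insert c A) o s hs ?_
  intro y hy
  rcases Finset.mem_insert.1 hy with rfl | hyA
  · -- y = c: pick any relay a ∈ A; {c ↮ (A ∪ {c}) ∖ c} ⊆ {a ↮ c}
    obtain ⟨a, ha⟩ := hA
    have hac : a ≠ y := fun h => hc (h ▸ ha)
    refine le_trans (measureReal_mono ?_) (hcut a ha)
    intro ω hω
    have h := hω a (Finset.mem_erase.2 ⟨hac, Finset.mem_insert_of_mem ha⟩)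
    exact fun hay => h (SimpleGraph.Reachable.symm hay)
  · have hyc : y ≠ c := fun h => hc (h ▸ hyA)
    refine le_trans (measureReal_mono ?_) (hcut y hyA)
    intro ω hω
    exact hω c (Finset.mem_erase.2 ⟨hyc.symm, Finset.mem_insert_self c A⟩)

/-- `H_{k+1} = H_k + 1/(k+1)` for the harmonic sums `H_k = Σ_{j<k} 1/(j+1)`. [folklore] -/
theorem harm_succ (k : ℕ) :
    (∑ j ∈ Finset.range (k + 1), (1 : ℝ) / (j + 1)) = (∑ j ∈ Finset.range k, (1 : ℝ) / (j + 1)) + 1 / (k + 1) := by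
  simp [Finset.sum_range_succ]

end HarmonicGluing

open HarmonicGluing

/-- **Harmonic event gluing.**  For `c ∉ A` and `s ≥ max_{a ∈ A} μ(a ↮ c)`:
`μ({o ↮ c} ∩ ⋃_{a∈A}{o ↔ a}) ≤ H_{|A|} · s`, `H_k = Σ_{j=1}^k 1/j`.
Recursion `X(A) = (1/|A|) Σ_{x∈A} [X(A∖x) + μ(pocket x)] ≤ H_{|A|−1} s + s/|A|` (lonely relay lemma for the pockets).
[cite: KozmaNitzan2024, Lemma 2 (p. 6) — via `Theorems.lonelyRelay`; the harmonic recursion is this file's] -/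
theorem eventGluing_harmonic {n : ℕ} (w : Sym2 (Fin n) → unitInterval) (o c : Fin n) (s : ℝ) (hs : 0 ≤ s) :
    ∀ (A : Finset (Fin n)), c ∉ A →
      (∀ a ∈ A, (prodBernoulli w).real (openConn a c : Set (BondConfig (Fin n)))ᶜ ≤ s) →
      (prodBernoulli w).real ((openConn o c : Set (BondConfig (Fin n)))ᶜ ∩ ⋃ a ∈ A, openConn o a) ≤
        (∑ j ∈ Finset.range A.card, (1 : ℝ) / (j + 1)) * s := by
  set μ := prodBernoulli w with hμ
  -- induction on the cardinality
  suffices H : ∀ (k : ℕ) (A : Finset (Fin n)), A.card = k → c ∉ A →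
      (∀ a ∈ A, μ.real (openConn a c : Set (BondConfig (Fin n)))ᶜ ≤ s) →
      μ.real ((openConn o c : Set (BondConfig (Fin n)))ᶜ ∩ ⋃ a ∈ A, openConn o a) ≤ (∑ j ∈ Finset.range A.card, (1 : ℝ) / (j + 1)) * s by
    intro A hc hcut; exact H A.card A rfl hc hcut
  intro k
  induction k with
  | zero =>
    intro A hA _ _
    rw [Finset.card_eq_zero] at hA
    subst hA
    simp
  | succ k ih =>
    intro A hA hc hcut
    have hApos : 0 < A.card := by omega
    have hAne : A.Nonempty := Finset.card_pos.1 hApos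
    -- the split at every x, summed over x ∈ A
    have hsum : (A.card : ℝ) * μ.real ((openConn o c : Set (BondConfig (Fin n)))ᶜ ∩ ⋃ a ∈ A, openConn o a) =
        ∑ x ∈ A, (μ.real ((openConn o c : Set (BondConfig (Fin n)))ᶜ ∩ ⋃ y ∈ A.erase x, openConn o y) +
          μ.real ((openConn o c : Set (BondConfig (Fin n)))ᶜ ∩ (openConn o x) ∩ ⋂ y ∈ A.erase x, (openConn o y)ᶜ)) := by
      rw [← Finset.sum_congr rfl fun x hx => exit_split_erase w A o c x hx]
      rw [Finset.sum_const, nsmul_eq_mul]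
    have hIH : ∀ x ∈ A, μ.real ((openConn o c : Set (BondConfig (Fin n)))ᶜ ∩ ⋃ y ∈ A.erase x, openConn o y) ≤
        (∑ j ∈ Finset.range k, (1 : ℝ) / (j + 1)) * s := by
      intro x hx
      have hcard : (A.erase x).card = k := by rw [Finset.card_erase_of_mem hx, hA]; rfl
      have := ih (A.erase x) hcard (fun h => hc (Finset.mem_of_mem_erase h))
        (fun a ha => hcut a (Finset.mem_of_mem_erase ha))
      rwa [hcard] at this
    have hpock := sum_pocket_le w A o c s hs hc hAne hcut
    have hbound : (A.card : ℝ) * μ.real ((openConn o c : Set (BondConfig (Fin n)))ᶜ ∩ ⋃ a ∈ A, openConn o a) ≤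
        (A.card : ℝ) * ((∑ j ∈ Finset.range k, (1 : ℝ) / (j + 1)) * s) + s := by
      rw [hsum, Finset.sum_add_distrib]
      have h1 : ∑ x ∈ A, μ.real ((openConn o c : Set (BondConfig (Fin n)))ᶜ ∩ ⋃ y ∈ A.erase x, openConn o y) ≤
          ∑ x ∈ A, (∑ j ∈ Finset.range k, (1 : ℝ) / (j + 1)) * s := Finset.sum_le_sum hIH
      rw [Finset.sum_const, nsmul_eq_mul] at h1
      linarith
    have hk1 : (A.card : ℝ) = (k : ℝ) + 1 := by rw [hA]; push_cast; ring
    rw [hA, harm_succ]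
    have hpos : (0 : ℝ) < (k : ℝ) + 1 := by positivity
    rw [hk1] at hbound
    -- divide by k+1
    have : μ.real ((openConn o c : Set (BondConfig (Fin n)))ᶜ ∩ ⋃ a ∈ A, openConn o a) ≤
        (∑ j ∈ Finset.range k, (1 : ℝ) / (j + 1)) * s + s / ((k : ℝ) + 1) := by
      rw [← sub_nonneg] at hbound ⊢
      have : ((k : ℝ) + 1) * ((∑ j ∈ Finset.range k, (1 : ℝ) / (j + 1)) * s + s / ((k : ℝ) + 1) -
          μ.real ((openConn o c : Set (BondConfig (Fin n)))ᶜ ∩ ⋃ a ∈ A, openConn o a)) =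
          ((k : ℝ) + 1) * ((∑ j ∈ Finset.range k, (1 : ℝ) / (j + 1)) * s) + s -
            ((k : ℝ) + 1) * μ.real ((openConn o c : Set (BondConfig (Fin n)))ᶜ ∩ ⋃ a ∈ A, openConn o a) := by
        field_simp
      nlinarith
    calc μ.real ((openConn o c : Set (BondConfig (Fin n)))ᶜ ∩ ⋃ a ∈ A, openConn o a)
        ≤ (∑ j ∈ Finset.range k, (1 : ℝ) / (j + 1)) * s + s / ((k : ℝ) + 1) := this
      _ = ((∑ j ∈ Finset.range k, (1 : ℝ) / (j + 1)) + 1 / ((k : ℝ) + 1)) * s := by ring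

/-- **Harmonic additive gluing**: `μ(o ↔ A) − H_{|A|}·t ≤ μ(o ↔ b)` whenever `μ(a ↔ b) ≥ 1 − t` for all `a ∈ A` (`b ∉ A`).
(`AdditiveGluing`, stmt-4576, is the same with `H_{|A|}` replaced by `1`; the tree's `logGluing` has `16(⌊log₂|A|⌋+1)`.)
[this file] -/
theorem additiveGluing_harmonic {n : ℕ} (w : Sym2 (Fin n) → unitInterval) (A : Finset (Fin n)) (o b : Fin n)
    (t : ℝ) (ht : 0 ≤ t) (hb : b ∉ A)
    (hrel : ∀ a ∈ A, 1 - t ≤ (prodBernoulli w).real (openConn a b : Set (BondConfig (Fin n)))) :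
    (prodBernoulli w).real (⋃ a ∈ A, (openConn o a : Set (BondConfig (Fin n)))) - (∑ j ∈ Finset.range A.card, (1 : ℝ) / (j + 1)) * t ≤
      (prodBernoulli w).real (openConn o b : Set (BondConfig (Fin n))) := by
  set μ := prodBernoulli w with hμ
  haveI : IsProbabilityMeasure μ := by rw [hμ]; infer_instance
  have hcut : ∀ a ∈ A, μ.real (openConn a b : Set (BondConfig (Fin n)))ᶜ ≤ t := by
    intro a ha
    have h1 := hrel a ha
    have h2 : μ.real (openConn a b : Set (BondConfig (Fin n)))ᶜ =
        1 - μ.real (openConn a b : Set (BondConfig (Fin n))) :=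
      probReal_compl_eq_one_sub MeasurableSet.of_discrete
    linarith
  have hX := eventGluing_harmonic w o b t ht A hb hcut
  have hsplit : μ.real (⋃ a ∈ A, (openConn o a : Set (BondConfig (Fin n)))) ≤
      μ.real (openConn o b : Set (BondConfig (Fin n))) +
        μ.real ((openConn o b : Set (BondConfig (Fin n)))ᶜ ∩ ⋃ a ∈ A, openConn o a) := by
    calc μ.real (⋃ a ∈ A, (openConn o a : Set (BondConfig (Fin n))))
        ≤ μ.real ((openConn o b : Set (BondConfig (Fin n))) ∪
            ((openConn o b : Set (BondConfig (Fin n)))ᶜ ∩ ⋃ a ∈ A, openConn o a)) := by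
          refine measureReal_mono fun ω hω => ?_
          by_cases hob : ω ∈ (openConn o b : Set (BondConfig (Fin n)))
          · exact Or.inl hob
          · exact Or.inr ⟨hob, hω⟩
      _ ≤ _ := measureReal_union_le _ _
  linarith


/-- **Harmonic event gluing without the side condition `c ∉ A`** (the relay `c` itself contributes nothing to the exit
event). [this file] -/
theorem eventGluing_harmonic' {n : ℕ} (w : Sym2 (Fin n) → unitInterval) (A : Finset (Fin n)) (o c : Fin n) (s : ℝ)
    (hs : 0 ≤ s) (hcut : ∀ a ∈ A, (prodBernoulli w).real (openConn a c : Set (BondConfig (Fin n)))ᶜ ≤ s) :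
    (prodBernoulli w).real ((openConn o c : Set (BondConfig (Fin n)))ᶜ ∩ ⋃ a ∈ A, openConn o a) ≤
      (∑ j ∈ Finset.range A.card, (1 : ℝ) / (j + 1)) * s := by
  set μ := prodBernoulli w with hμ
  have hsub : ((openConn o c : Set (BondConfig (Fin n)))ᶜ ∩ ⋃ a ∈ A, openConn o a) ⊆
      ((openConn o c : Set (BondConfig (Fin n)))ᶜ ∩ ⋃ a ∈ A.erase c, openConn o a) := by
    rintro ω ⟨hoc, hU⟩
    simp only [mem_iUnion, exists_prop] at hU
    obtain ⟨a, ha, hoa⟩ := hU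
    have hac : a ≠ c := by rintro rfl; exact hoc hoa
    refine ⟨hoc, ?_⟩
    simp only [mem_iUnion, exists_prop]
    exact ⟨a, Finset.mem_erase.2 ⟨hac, ha⟩, hoa⟩
  have h1 := eventGluing_harmonic w o c s hs (A.erase c) (Finset.notMem_erase c A)
    (fun a ha => hcut a (Finset.mem_of_mem_erase ha))
  have hmono : (∑ j ∈ Finset.range (A.erase c).card, (1 : ℝ) / (j + 1)) ≤ (∑ j ∈ Finset.range A.card, (1 : ℝ) / (j + 1)) := by
    apply Finset.sum_le_sum_of_subset_of_nonneg
    · exact Finset.range_mono (Finset.card_erase_le)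
    · intro j _ _; positivity
  calc μ.real ((openConn o c : Set (BondConfig (Fin n)))ᶜ ∩ ⋃ a ∈ A, openConn o a)
      ≤ μ.real ((openConn o c : Set (BondConfig (Fin n)))ᶜ ∩ ⋃ a ∈ A.erase c, openConn o a) := measureReal_mono hsub
    _ ≤ (∑ j ∈ Finset.range (A.erase c).card, (1 : ℝ) / (j + 1)) * s := h1
    _ ≤ (∑ j ∈ Finset.range A.card, (1 : ℝ) / (j + 1)) * s := mul_le_mul_of_nonneg_right hmono hs

/-- **Kozma–Nitzan near-one gluing (Conjecture 3) uniformly on `|A| ≤ K`, harmonic rate**: with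
`δ = ε / (2 (H_K + 1))`, `μ(o ↔ A) > 1 − δ` and `μ(a ↔ b) > 1 − δ` (`a ∈ A`, `|A| ≤ K`) give `μ(o ↔ b) > 1 − ε`.
(The tree's `nearOneGluing_of_card_lt_two_pow` has `δ = ε/(16 L + 2)` for `|A| < 2^L`.) [this file] -/
theorem nearOneGluing_of_card_le_harmonic (K : ℕ) (ε : ℝ) (hε : 0 < ε) :
    ∃ δ : ℝ, 0 < δ ∧ ∀ (n : ℕ) (w : Sym2 (Fin n) → unitInterval) (A : Finset (Fin n)) (o b : Fin n), A.card ≤ K →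
      1 - δ < (prodBernoulli w).real (⋃ a ∈ A, (openConn o a : Set (BondConfig (Fin n)))) →
      (∀ a ∈ A, 1 - δ < (prodBernoulli w).real (openConn a b : Set (BondConfig (Fin n)))) →
      1 - ε < (prodBernoulli w).real (openConn o b : Set (BondConfig (Fin n))) := by
  set H : ℝ := (∑ j ∈ Finset.range K, (1 : ℝ) / (j + 1)) with hH
  have hH0 : 0 ≤ H := Finset.sum_nonneg fun j _ => by positivity
  refine ⟨ε / (2 * (H + 1)), by positivity, ?_⟩
  intro n w A o b hK hoA hAb
  set μ := prodBernoulli w with hμ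
  haveI : IsProbabilityMeasure μ := by rw [hμ]; infer_instance
  set δ := ε / (2 * (H + 1)) with hδ
  have hδpos : 0 < δ := by positivity
  have hcut : ∀ a ∈ A, μ.real (openConn a b : Set (BondConfig (Fin n)))ᶜ ≤ δ := by
    intro a ha
    have h1 := hAb a ha
    have h2 : μ.real (openConn a b : Set (BondConfig (Fin n)))ᶜ = 1 - μ.real (openConn a b : Set (BondConfig (Fin n))) :=
      probReal_compl_eq_one_sub MeasurableSet.of_discrete
    linarith
  have hX := eventGluing_harmonic' w A o b δ hδpos.le hcut
  have hmono : (∑ j ∈ Finset.range A.card, (1 : ℝ) / (j + 1)) ≤ H := by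
    rw [hH]
    apply Finset.sum_le_sum_of_subset_of_nonneg
    · exact Finset.range_mono hK
    · intro j _ _; positivity
  have hX' : μ.real ((openConn o b : Set (BondConfig (Fin n)))ᶜ ∩ ⋃ a ∈ A, openConn o a) ≤ H * δ :=
    le_trans hX (mul_le_mul_of_nonneg_right hmono hδpos.le)
  have hsplit : μ.real (⋃ a ∈ A, (openConn o a : Set (BondConfig (Fin n)))) ≤
      μ.real (openConn o b : Set (BondConfig (Fin n))) +
        μ.real ((openConn o b : Set (BondConfig (Fin n)))ᶜ ∩ ⋃ a ∈ A, openConn o a) := by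
    calc μ.real (⋃ a ∈ A, (openConn o a : Set (BondConfig (Fin n))))
        ≤ μ.real ((openConn o b : Set (BondConfig (Fin n))) ∪
            ((openConn o b : Set (BondConfig (Fin n)))ᶜ ∩ ⋃ a ∈ A, openConn o a)) := by
          refine measureReal_mono fun ω hω => ?_
          by_cases hob : ω ∈ (openConn o b : Set (BondConfig (Fin n)))
          · exact Or.inl hob
          · exact Or.inr ⟨hob, hω⟩
      _ ≤ _ := measureReal_union_le _ _
  have h2 : 2 * (H + 1) * δ = ε := by rw [hδ]; field_simp
  have hHd : H * δ + δ = ε / 2 := by linear_combination h2 / 2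
  linarith

end Summit.CriticalPhenomena.PercolationContinuityZ3.Theorems

end
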